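import Summits.BirchSwinnertonDyer.BirchSwinnertonDyer.Theorems.PrintCf2RamifiedOffTYZCasselsTateAdjugatePinJumpOne
import Literature.NumberTheory.EllipticCurves.Cassels1998.ExplicitPairingSelmerTwo
import Literature.NumberTheory.EllipticCurves.TwoDescentLinearConditions
import HarnessLib

/-!
# The level-two Selmer bit of C⁺ and the adjugate pin IN CASSELS' HILBERT-SYMBOL CURRENCY (crux stmt-BirchSwinnertonDyer-20509
# `RamifiedOffTYZOfFacts`, line `offtyz-v7`, LEAD cruxlead-20509 g22, cycle 23) — the junction of (E) (g21/g22) with the typer's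
# (S) input `Cassels1998.pairing_selmerTwo_eq_hilbertSymbolProduct` (ty2 g48, p776637)

HONEST FRAMING (cell `bsd-print-cf2`, route `PrintCf2`; `--supports stmt-BirchSwinnertonDyer-20509`; `def`-free, no `sorry`). ONE named
fact enters, as a HYPOTHESIS: `hC : Cassels1998.pairing_selmerTwo_eq_hilbertSymbolProduct` (Cassels 1998: the Cassels–Tate form on `Sel₂`
of `y² = (x − e₁)(x − e₂)(x − e₃)` IS Cassels' product of local Hilbert symbols of tangent forms; no `_holds` possible today). Nothing is
computed for a specific `n` (that needs Lemma 7.2 as an evaluation theorem and explicit local points — not in the tree). BSD is not proved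
by any of this; no class is closed; 20509 / 23431 / 23432 stay OPEN.

WHAT. `E_n : y² = x³ − n²x = (x + n)·x·(x − n)` is a Cassels curve (`congruentNumberCurve_eq_cassels`, roots `(−n, 0, n)` in the order of
the tree's `TwoDescentLocal.splitTwoTorsion_cn`; components `d₁ ↔ x + n`, `d₂ ↔ x`, `d₁d₂d₃ ∈ ℚˣ²` — `Cassels1998.HasComponents`). Granted `hC`:

* §1 `exists_ctSelmer_two_cassels` — the Cassels–Tate form `C` on `Sel₂(E_n)` (values in `ℚ/ℤ`, alternating, both kernels
  `[2]_* Sel₄(E_n)`) with **`⟨s, t⟩ = 0 ⟺` Cassels' global symbol of `(Λ_s, Λ_t)` is `+1` for every datum** (`Datum.IsEven`), data exist.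
* §1 `sha_dichotomy_of_alternating` (any `E/K`, fact-free) — `#Ш[2] = 4` and ONE alternating `C` on `Sel₂` with left kernel `[2]_* Sel₄`
  give `Ш[4] = Ш[2] ∨ Ш[2] ≤ 2Ш[4]` (the radical's index divides `4` and is `≠ 2`); so `natCard_selmerGroup_four_eq_or_of_cassels`:
  **`#Sel₄(E_n) ∈ {2⁶, 2⁸}` on category D of rank one from `hC` alone** (g21 used the global CT fact).
* §2 (category D of rank one: `n` square-free, `rank E_n(ℚ) = 1`, `#Sel₂(E_n) = 2⁵`):
  ★ `natCard_selmerGroup_four_eq_two_pow_eight_iff_symbols` — **`#Sel₄(E_n) = 2⁸ ⟺` every Cassels symbol between Selmer triples is `+1`**;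
  ★ `natCard_selmerGroup_four_eq_two_pow_six_iff_symbols` — **`#Sel₄(E_n) = 2⁶ ⟺` SOME Cassels symbol between two Selmer triples is `−1`**:
  the `#Sel₄ = 2⁶` hypothesis of C⁺ (item 23431) is a finite Hilbert-symbol computation (the census's `ellrank` step, now by name);
  ★ `…_iff_symbols₃` — with three generators over Kummer classes: `#Sel₄ = 2⁸ ⟺` the THREE symbols `⟨Λ₁,Λ₂⟩, ⟨Λ₁,Λ₃⟩, ⟨Λ₂,Λ₃⟩` are `+1`.
* §3 (jump-one class; statements polymorphic in the `DecidableEq ℚ` behind the group law):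
  ★★ `exists_odd_point_kummer_eq_symbolAdjugate` — for three Selmer classes generating over torsion classes with Cassels data `𝒟₁ 𝒟₂`:
  a rational point `P ∉ E_n(ℚ)[2] + 2E_n(ℚ)` has **`κ₂(P) = [⟨Λ₂,Λ₃⟩ = −1]s₁ + [⟨Λ₁,Λ₃⟩ = −1]s₂ + [⟨Λ₁,Λ₂⟩ = −1]s₃`** — the generator's
  `2`-Selmer coordinates ARE three global Hilbert-symbol parities; `kummer_eq_or_eq_add_symbolAdjugate` — every point is `≡ 0` or that.

References: Cassels 1998 via Wang 2016 §2.2 / Wang–Zhang 2022 §2.3; Milne *ADT* I §6; Silverman *AEC* X; the card.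
-/

noncomputable section

open scoped Classical

open WeierstrassCurve Literature.NumberTheory.EllipticCurves Literature.NumberTheory.EllipticCurves.Cassels1998
  Summit.BirchSwinnertonDyer.PrintCf2.CasselsTatePin Summit.BirchSwinnertonDyer.PrintCf2.AdjugatePin

set_option autoImplicit false

universe u

namespace Summit.BirchSwinnertonDyer.PrintCf2.CasselsSymbols

/-! ## §1 The dichotomy from ONE alternating form (any `E/K`), and `E_n` as a Cassels curve -/

section Dichotomy

variable {K : Type u} [Field K] [NumberField K] (W : WeierstrassCurve K) [W.IsElliptic] {T : Type*} [AddCommGroup T]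

omit [W.IsElliptic] in
/-- **An alternating form cannot be non-degenerate on a group of order two**: the radical `R = [2]_* Sel₄(E/K)` of an alternating
pairing `C` on `Sel₂(E/K)` with left kernel `R` never has index `2` (if `Sel₂ = R ⊔ (s₀ + R)` then `⟨s₀, ·⟩ ≡ 0`, so `s₀ ∈ R`). [folklore] -/
theorem index_range_selmerZSMul_two_ne_two (C : selmerGroup W 2 →+ selmerGroup W 2 →+ T) (halt : ∀ s, C s s = 0)
    (hl : ∀ s, (∀ t, C s t = 0) ↔ s ∈ (selmerZSMul W (d := 2) (n := 4) 2 four_dvd_two_mul_two).range) :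
    (selmerZSMul W (d := 2) (n := 4) 2 four_dvd_two_mul_two).range.index ≠ 2 := by
  set R := (selmerZSMul W (d := 2) (n := 4) 2 four_dvd_two_mul_two).range with hR
  intro h2
  obtain ⟨a, ha⟩ := AddSubgroup.index_eq_two_iff.mp h2
  have haR : a ∉ R := fun haR => by
    rcases ha 0 with ⟨h1, h2⟩ | ⟨h1, h2⟩
    · exact h2 R.zero_mem
    · exact h2 (by rwa [zero_add])
  apply haR
  rw [← hl a]
  intro t
  by_cases ht : t ∈ R
  · -- `t` radical: `⟨a, t⟩ = −⟨t, a⟩ = 0`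
    rw [AdjugateForm.apply_eq_neg_apply C halt a t, ((hl t).mpr ht) a, neg_zero]
  · -- `t ∉ R` ⇒ `t + a ∈ R`, and `⟨a, t⟩ = ⟨a, t + a⟩ − ⟨a, a⟩`
    have hta : t + a ∈ R := by
      rcases ha t with ⟨h1, -⟩ | ⟨h1, -⟩
      · exact h1
      · exact absurd h1 ht
    have h := ((hl (t + a)).mpr hta) a
    rw [AdjugateForm.apply_eq_neg_apply C halt (t + a) a, neg_eq_zero, map_add, halt a, add_zero] at h
    exact h

/-- **DICHOTOMY from one alternating form** (fact-free given the form): for an elliptic curve over a number field with `#Ш[2] = 4` and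
an alternating pairing `C` on `Sel₂(E/K)` whose left kernel is `[2]_* Sel₄(E/K)`: EITHER `Ш[4] = Ш[2]` OR `Ш[2] ≤ 2·Ш[4]`. (The index of
the radical equals `[Ш[2] : 2Ш[4] ∩ Ш[2]]`, divides `4`, and is not `2`.) Same conclusion as g21's `sha_dichotomy_of_natCard_sha_two_eq_four`,
which assumed the CT fact for ALL curves over `K`. [cite: MilneADT2006, Ch. I §6 Thm. 6.13(a), Lemma 6.17] [cite: Cassels1962ArithmeticIV] -/
theorem sha_dichotomy_of_alternating (C : selmerGroup W 2 →+ selmerGroup W 2 →+ T) (halt : ∀ s, C s s = 0)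
    (hl : ∀ s, (∀ t, C s t = 0) ↔ s ∈ (selmerZSMul W (d := 2) (n := 4) 2 four_dvd_two_mul_two).range)
    (h4 : Nat.card (AddSubgroup.torsionBy W.sha (2 : ℤ)) = 4) :
    (∀ w : W.sha, (4 : ℤ) • w = 0 → (2 : ℤ) • w = 0) ∨
      (∀ x : W.sha, (2 : ℤ) • x = 0 → ∃ w : W.sha, (4 : ℤ) • w = 0 ∧ (2 : ℤ) • w = x) := by
  set S2 : AddSubgroup W.sha := AddSubgroup.torsionBy W.sha (2 : ℤ) with hS2
  haveI : Finite S2 := Nat.finite_of_card_ne_zero (by rw [h4]; norm_num)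
  -- `D = 2·Ш[4]` seen inside `Ш[2]`
  let D : AddSubgroup S2 :=
    { carrier := {x | ∃ w : W.sha, (4 : ℤ) • w = 0 ∧ (2 : ℤ) • w = (x : W.sha)}
      zero_mem' := ⟨0, smul_zero _, by rw [smul_zero]; rfl⟩
      add_mem' := by
        rintro x y ⟨w, hw4, hw2⟩ ⟨w', hw4', hw2'⟩
        exact ⟨w + w', by rw [smul_add, hw4, hw4', add_zero], by rw [smul_add, hw2, hw2']; rfl⟩
      neg_mem' := by
        rintro x ⟨w, hw4, hw2⟩
        exact ⟨-w, by rw [smul_neg, hw4, neg_zero], by rw [smul_neg, hw2]; rfl⟩ }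
  have hD : ∀ x : S2, x ∈ D ↔ ∃ w : W.sha, (4 : ℤ) • w = 0 ∧ (2 : ℤ) • w = (x : W.sha) := fun x => Iff.rfl
  -- `f = π₂ : Sel₂ ↠ Ш[2]`
  let f : selmerGroup W 2 →+ S2 := (selmerToSha W 2).codRestrict S2 fun s =>
    (mem_sha_torsionBy_iff W 2 _).mpr (zsmul_selmerToSha W 2 s)
  have hf : ∀ s, ((f s : S2) : W.sha) = selmerToSha W 2 s := fun s => rfl
  have hfsurj : Function.Surjective f := by
    intro x
    obtain ⟨s, hs⟩ := exists_selmerToSha_eq W two_ne_zero (x : W.sha) ((mem_sha_torsionBy_iff W 2 _).mp x.2)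
    exact ⟨s, Subtype.ext (by rw [hf, hs])⟩
  -- `[2]_* Sel₄ = f⁻¹(D)`
  have hR : (selmerZSMul W (d := 2) (n := 4) 2 four_dvd_two_mul_two).range = D.comap f := by
    ext s
    rw [mem_range_selmerZSMul_two_iff, AddSubgroup.mem_comap, hD, hf]
  -- index transport: `[Ш[2] : D] = [Sel₂ : [2]_* Sel₄]` divides `#Ш[2] = 4` and is not `2`
  have hidx : D.index = (selmerZSMul W (d := 2) (n := 4) 2 four_dvd_two_mul_two).range.index := by
    rw [← AddSubgroup.index_comap_of_surjective D hfsurj, ← hR]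
  have hdvd : D.index ∣ 4 := h4 ▸ D.index_dvd_card
  have hne2 : D.index ≠ 2 := hidx ▸ index_range_selmerZSMul_two_ne_two W C halt hl
  have hcases : D.index = 1 ∨ D.index = 4 := by
    have hle : D.index ≤ 4 := Nat.le_of_dvd (by norm_num) hdvd
    interval_cases h : D.index
    · exact absurd hdvd (by norm_num)
    · exact Or.inl rfl
    · exact absurd rfl hne2
    · exact absurd hdvd (by norm_num)
    · exact Or.inr rfl
  rcases hcases with h1 | h4'
  · -- index 1: `D = Ш[2]`, the ZERO regime
    right
    have htop : D = ⊤ := AddSubgroup.index_eq_one.mp h1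
    intro x hx
    have hxD : (⟨x, (mem_sha_torsionBy_iff W 2 x).mpr hx⟩ : S2) ∈ D := by
      rw [htop]; exact AddSubgroup.mem_top _
    exact (hD _).mp hxD
  · -- index 4 = #Ш[2]: `D = 0`, the PIN regime
    left
    have hcard : Nat.card D = 1 := by
      have h := D.card_mul_index
      rw [h4', h4] at h
      omega
    have hbot : D = ⊥ := AddSubgroup.eq_bot_of_card_le D (by rw [hcard])
    intro w hw
    have h2w : (2 : ℤ) • ((2 : ℤ) • w) = 0 := by
      rw [smul_smul]; exact hw
    have hmem : (⟨(2 : ℤ) • w, (mem_sha_torsionBy_iff W 2 _).mpr h2w⟩ : S2) ∈ D := (hD _).mpr ⟨w, hw, rfl⟩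
    rw [hbot, AddSubgroup.mem_bot] at hmem
    exact congrArg Subtype.val hmem

end Dichotomy

section CongruentNumber

variable {n : ℕ}

/-- `E_n : y² = x³ − n²x` is Cassels' model `y² = (x − e₁)(x − e₂)(x − e₃)` with `(e₁, e₂, e₃) = (−n, 0, n)` (the order of the tree's
`TwoDescentLocal.splitTwoTorsion_cn`). [cite: SilvermanAEC2009, Prop. X.1.4] -/
theorem congruentNumberCurve_eq_cassels (n : ℕ) :
    congruentNumberCurve n = ⟨0, -(-(n : ℚ) + 0 + n), 0, -(n : ℚ) * 0 + -(n : ℚ) * n + 0 * n, -(-(n : ℚ) * 0 * n)⟩ := by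
  rw [congruentNumberCurve]
  congr 1 <;> ring

/-- **The Cassels–Tate form on `Sel₂(E_n)`, computed by Cassels' recipe** (granted the fact): an alternating `C` with values in `ℚ/ℤ`,
left and right kernels `[2]_* Sel₄(E_n)`, such that for Selmer classes `s, t` with component triples `Λ = d`, `Λ' = d'` (roots
`(−n, 0, n)`) a Cassels datum exists and, for EVERY datum, `⟨s, t⟩ = 0 ⟺` the number of places with local term `−1` is even.
[cite: Cassels1998, the pairing on S⁽²⁾ and its kernel (via Wang 2016 §2.2, Wang–Zhang 2022 §2.3)] [cite: MilneADT2006, Ch. I §6 Lemma 6.17] -/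
theorem exists_ctSelmer_two_cassels (hC : pairing_selmerTwo_eq_hilbertSymbolProduct) [(congruentNumberCurve n).IsElliptic] :
    ∃ C : selmerGroup (congruentNumberCurve n) 2 →+ selmerGroup (congruentNumberCurve n) 2 →+ AddCircle (1 : ℚ),
      (∀ s, C s s = 0) ∧
        (∀ s, (∀ t, C s t = 0) ↔ s ∈ (selmerZSMul (congruentNumberCurve n) (d := 2) (n := 4) 2 four_dvd_two_mul_two).range) ∧
          (∀ t, (∀ s, C s t = 0) ↔ t ∈ (selmerZSMul (congruentNumberCurve n) (d := 2) (n := 4) 2 four_dvd_two_mul_two).range) ∧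
            ∀ (s t : selmerGroup (congruentNumberCurve n) 2) (d d' : Fin 3 → ℚˣ),
              HasComponents (congruentNumberCurve n) (TwoDescentLocal.splitTwoTorsion_cn n)
                  (s : galH1Torsion (congruentNumberCurve n) 2) d →
                HasComponents (congruentNumberCurve n) (TwoDescentLocal.splitTwoTorsion_cn n)
                    (t : galH1Torsion (congruentNumberCurve n) 2) d' →
                  Nonempty (Datum ![-(n : ℚ), 0, n] (fun i => (d i : ℚ))) ∧
                    ∀ 𝒟 : Datum ![-(n : ℚ), 0, n] (fun i => (d i : ℚ)),
                      C s t = 0 ↔ 𝒟.IsEven (fun i => (d' i : ℚ)) := by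
  obtain ⟨B, halt, hlev, hB⟩ := hC (-(n : ℚ)) 0 n (congruentNumberCurve n) (congruentNumberCurve_eq_cassels n)
    (TwoDescentLocal.splitTwoTorsion_cn n)
  refine ⟨ctSelmer B 2 2, ctSelmer_self_eq_zero B halt 2, selmerTwo_kernel_iff_mem_range B hlev, fun t => ?_,
    fun s t d d' hs ht => ?_⟩
  · rw [ctSelmer_right_kernel_iff B halt hlev two_ne_zero two_ne_zero t, AddMonoidHom.mem_range]
    exact Iff.rfl
  · obtain ⟨hne, h𝒟⟩ := hB s t d d' hs ht
    exact ⟨hne, fun 𝒟 => by rw [Datum.isEven_iff]; exact (h𝒟 𝒟).2⟩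

/-- **`#Sel₄(E_n) ∈ {2⁶, 2⁸}` on category D of rank one, from Cassels' fact alone**: for square-free `n` with `rank E_n(ℚ) = 1` and
`#Sel₂(E_n) = 2⁵`, granted `hC`. (g21's `natCard_selmerGroup_four_eq_or` assumed the CT fact for all curves over `ℚ`; one alternating
form on `Sel₂(E_n)` with the right kernel suffices.) [cite: Cassels1998, kernel of the pairing (via Wang 2016 §1)]
[cite: HeathBrown1994SelmerCongruentII, §1] -/
theorem natCard_selmerGroup_four_eq_or_of_cassels (hC : pairing_selmerTwo_eq_hilbertSymbolProduct) (hsq : Squarefree n)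
    [(congruentNumberCurve n).IsElliptic] (hr : (congruentNumberCurve n).mordellWeilRank = 1)
    (h₂ : Nat.card ((congruentNumberCurve n).selmerGroup 2) = 2 ^ 5) :
    Nat.card ((congruentNumberCurve n).selmerGroup 4) = 2 ^ 6 ∨
      Nat.card ((congruentNumberCurve n).selmerGroup 4) = 2 ^ 8 := by
  obtain ⟨C, halt, hl, -, -⟩ := exists_ctSelmer_two_cassels (n := n) hC
  rcases sha_dichotomy_of_alternating (congruentNumberCurve n) C halt hl (natCard_sha_two_eq_four hsq hr h₂) with hexp | hdiv
  · exact Or.inl ((natCard_selmerGroup_four_eq_two_pow_six_iff hsq hr h₂).mpr hexp)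
  · exact Or.inr ((natCard_selmerGroup_four_eq_two_pow_eight_iff hsq hr h₂).mpr hdiv)

/-! ## §2 The level-two Selmer bit of C⁺ as Hilbert-symbol parities (category D of rank one) -/

/-- ★ **`#Sel₄(E_n) = 2⁸ ⟺ every Cassels symbol is `+1`**: for square-free `n` with `rank E_n(ℚ) = 1`, `#Sel₂(E_n) = 2⁵`, granted
`hC`: `#Sel₄(E_n) = 2⁸` iff for all Selmer classes `s, t`, all component triples and every Cassels datum, the number of places with
local term `−1` is even (the census B-label). [cite: Cassels1998, the pairing and its kernel (via Wang 2016 §2.2)]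
[cite: HeathBrown1994SelmerCongruentII, §1] -/
theorem natCard_selmerGroup_four_eq_two_pow_eight_iff_symbols (hC : pairing_selmerTwo_eq_hilbertSymbolProduct)
    (hsq : Squarefree n) [(congruentNumberCurve n).IsElliptic] (hr : (congruentNumberCurve n).mordellWeilRank = 1)
    (h₂ : Nat.card ((congruentNumberCurve n).selmerGroup 2) = 2 ^ 5) :
    Nat.card ((congruentNumberCurve n).selmerGroup 4) = 2 ^ 8 ↔
      ∀ (s t : selmerGroup (congruentNumberCurve n) 2) (d d' : Fin 3 → ℚˣ),
        HasComponents (congruentNumberCurve n) (TwoDescentLocal.splitTwoTorsion_cn n)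
            (s : galH1Torsion (congruentNumberCurve n) 2) d →
          HasComponents (congruentNumberCurve n) (TwoDescentLocal.splitTwoTorsion_cn n)
              (t : galH1Torsion (congruentNumberCurve n) 2) d' →
            ∀ 𝒟 : Datum ![-(n : ℚ), 0, n] (fun i => (d i : ℚ)), 𝒟.IsEven (fun i => (d' i : ℚ)) := by
  obtain ⟨C, -, hl, -, hB⟩ := exists_ctSelmer_two_cassels (n := n) hC
  rw [← forall_forall_apply_eq_zero_iff_selmerFour hsq hr h₂ C hl]
  constructor
  · intro h s t d d' hs ht 𝒟
    exact ((hB s t d d' hs ht).2 𝒟).mp (h s t)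
  · intro h s t
    obtain ⟨d, hs⟩ := exists_hasComponents (congruentNumberCurve n) (TwoDescentLocal.splitTwoTorsion_cn n)
      (s : galH1Torsion (congruentNumberCurve n) 2)
    obtain ⟨d', ht⟩ := exists_hasComponents (congruentNumberCurve n) (TwoDescentLocal.splitTwoTorsion_cn n)
      (t : galH1Torsion (congruentNumberCurve n) 2)
    obtain ⟨⟨𝒟⟩, h𝒟⟩ := hB s t d d' hs ht
    exact (h𝒟 𝒟).mpr (h s t d d' hs ht 𝒟)

/-- ★ **`#Sel₄(E_n) = 2⁶ ⟺ SOME Cassels symbol is `−1`**: for square-free `n` with `rank E_n(ℚ) = 1`, `#Sel₂(E_n) = 2⁵`, granted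
`hC`: the `#Sel₄(E_n) = 2⁶` hypothesis of C⁺ (item 23431) holds iff there are Selmer classes `s, t` with component triples and a
Cassels datum whose global symbol is `−1` (an odd number of odd places) — a finite Hilbert-symbol certificate.
[cite: Cassels1998, the pairing and its kernel (via Wang 2016 §2.2)] [cite: HeathBrown1994SelmerCongruentII, §1] -/
theorem natCard_selmerGroup_four_eq_two_pow_six_iff_symbols (hC : pairing_selmerTwo_eq_hilbertSymbolProduct)
    (hsq : Squarefree n) [(congruentNumberCurve n).IsElliptic] (hr : (congruentNumberCurve n).mordellWeilRank = 1)
    (h₂ : Nat.card ((congruentNumberCurve n).selmerGroup 2) = 2 ^ 5) :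
    Nat.card ((congruentNumberCurve n).selmerGroup 4) = 2 ^ 6 ↔
      ∃ (s t : selmerGroup (congruentNumberCurve n) 2) (d d' : Fin 3 → ℚˣ),
        HasComponents (congruentNumberCurve n) (TwoDescentLocal.splitTwoTorsion_cn n)
            (s : galH1Torsion (congruentNumberCurve n) 2) d ∧
          HasComponents (congruentNumberCurve n) (TwoDescentLocal.splitTwoTorsion_cn n)
              (t : galH1Torsion (congruentNumberCurve n) 2) d' ∧
            ∃ 𝒟 : Datum ![-(n : ℚ), 0, n] (fun i => (d i : ℚ)), ¬ 𝒟.IsEven (fun i => (d' i : ℚ)) := by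
  have h8 := natCard_selmerGroup_four_eq_two_pow_eight_iff_symbols hC hsq hr h₂
  constructor
  · intro h6
    by_contra hne
    have : Nat.card ((congruentNumberCurve n).selmerGroup 4) = 2 ^ 8 :=
      h8.mpr fun s t d d' hs ht 𝒟 => by_contra fun hodd => hne ⟨s, t, d, d', hs, ht, 𝒟, hodd⟩
    rw [h6] at this
    norm_num at this
  · rintro ⟨s, t, d, d', hs, ht, 𝒟, hodd⟩
    rcases natCard_selmerGroup_four_eq_or_of_cassels hC hsq hr h₂ with h6 | h8'
    · exact h6
    · exact absurd (h8.mp h8' s t d d' hs ht 𝒟) hodd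

/-- ★ **With three generators: `#Sel₄(E_n) = 2⁸ ⟺` the three symbols `⟨Λ₁,Λ₂⟩, ⟨Λ₁,Λ₃⟩, ⟨Λ₂,Λ₃⟩` are `+1`** (category D of rank
one, granted `hC`): for the Cassels–Tate form `C` of `exists_ctSelmer_two_cassels` and Selmer classes `s₁ s₂ s₃` generating `Sel₂(E_n)`
over Kummer classes, with component triples `dᵢ` and data `𝒟ᵢ`. The card's «B ⟺ AND of three Rédei-type CT entries» with the
entries as symbol parities. [cite: Cassels1998, the pairing (via Wang–Zhang 2022 §2.3)] [cite: HeathBrown1994SelmerCongruentII, §1] -/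
theorem natCard_selmerGroup_four_eq_two_pow_eight_iff_symbols₃ (hsq : Squarefree n) [(congruentNumberCurve n).IsElliptic]
    (hr : (congruentNumberCurve n).mordellWeilRank = 1)
    (h₂ : Nat.card ((congruentNumberCurve n).selmerGroup 2) = 2 ^ 5)
    (C : selmerGroup (congruentNumberCurve n) 2 →+ selmerGroup (congruentNumberCurve n) 2 →+ AddCircle (1 : ℚ))
    (halt : ∀ s, C s s = 0)
    (hl : ∀ s, (∀ t, C s t = 0) ↔
      s ∈ (selmerZSMul (congruentNumberCurve n) (d := 2) (n := 4) 2 four_dvd_two_mul_two).range)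
    (hB : ∀ (s t : selmerGroup (congruentNumberCurve n) 2) (d d' : Fin 3 → ℚˣ),
      HasComponents (congruentNumberCurve n) (TwoDescentLocal.splitTwoTorsion_cn n) (s : galH1Torsion (congruentNumberCurve n) 2) d →
        HasComponents (congruentNumberCurve n) (TwoDescentLocal.splitTwoTorsion_cn n) (t : galH1Torsion (congruentNumberCurve n) 2) d' →
          Nonempty (Datum ![-(n : ℚ), 0, n] (fun i => (d i : ℚ))) ∧
            ∀ 𝒟 : Datum ![-(n : ℚ), 0, n] (fun i => (d i : ℚ)), C s t = 0 ↔ 𝒟.IsEven (fun i => (d' i : ℚ)))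
    (hdiv : ∀ P : geomPoints (congruentNumberCurve n), ∃ Q : geomPoints (congruentNumberCurve n), (2 : ℤ) • Q = P)
    (s₁ s₂ s₃ : selmerGroup (congruentNumberCurve n) 2) (d₁ d₂ d₃ : Fin 3 → ℚˣ)
    (hd₁ : HasComponents (congruentNumberCurve n) (TwoDescentLocal.splitTwoTorsion_cn n) (s₁ : galH1Torsion (congruentNumberCurve n) 2) d₁)
    (hd₂ : HasComponents (congruentNumberCurve n) (TwoDescentLocal.splitTwoTorsion_cn n) (s₂ : galH1Torsion (congruentNumberCurve n) 2) d₂)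
    (hd₃ : HasComponents (congruentNumberCurve n) (TwoDescentLocal.splitTwoTorsion_cn n) (s₃ : galH1Torsion (congruentNumberCurve n) 2) d₃)
    (𝒟₁ : Datum ![-(n : ℚ), 0, n] (fun i => (d₁ i : ℚ))) (𝒟₂ : Datum ![-(n : ℚ), 0, n] (fun i => (d₂ i : ℚ)))
    (hgen : ∀ t : selmerGroup (congruentNumberCurve n) 2, ∃ (P : (congruentNumberCurve n).toAffine.Point) (b₁ b₂ b₃ : ℤ),
      (t : galH1Torsion (congruentNumberCurve n) 2) = kummerMapTorsion (congruentNumberCurve n) 2 hdiv P +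
        ((b₁ • s₁ + b₂ • s₂ + b₃ • s₃ : selmerGroup (congruentNumberCurve n) 2) : galH1Torsion (congruentNumberCurve n) 2)) :
    Nat.card ((congruentNumberCurve n).selmerGroup 4) = 2 ^ 8 ↔
      (𝒟₁.IsEven (fun i => (d₂ i : ℚ)) ∧ 𝒟₁.IsEven (fun i => (d₃ i : ℚ)) ∧ 𝒟₂.IsEven (fun i => (d₃ i : ℚ))) := by
  rw [natCard_selmerGroup_four_eq_two_pow_eight_iff_entries hsq hr h₂ C halt hl hdiv s₁ s₂ s₃ hgen,
    (hB s₁ s₂ d₁ d₂ hd₁ hd₂).2 𝒟₁, (hB s₁ s₃ d₁ d₃ hd₁ hd₃).2 𝒟₁, (hB s₂ s₃ d₂ d₃ hd₂ hd₃).2 𝒟₂]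

end CongruentNumber

/-! ## §3 The adjugate pin in symbols (jump-one class)

The statements carry point arithmetic on `E_n(ℚ)`, whose group law depends on a `DecidableEq ℚ` instance; they are POLYMORPHIC in it
(binder `[DecidableEq ℚ]`, so they apply under `ℚ`'s own instance and under the classical one of the generic Kummer lemmas alike); each
proof first replaces the instance by the classical one (`Subsingleton.elim`) and then invokes `…AdjugatePinJumpOne` §3. -/

section JumpOne

variable {n : ℕ}

/-- ★★ **THE GENERATOR'S `2`-SELMER COORDINATES ARE THREE HILBERT-SYMBOL PARITIES**: on the jump-one class (square-free `n`,
`rank E_n(ℚ) = 1`, `#Sel₂(E_n) = 2⁵`, `#Sel₄(E_n) = 2⁶`), for the Cassels–Tate form `C` computed by Cassels' recipe (`hB`, from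
`exists_ctSelmer_two_cassels`) and three Selmer classes `s₁ s₂ s₃` generating `Sel₂(E_n)` over the torsion classes, with component
triples `dᵢ` and Cassels data `𝒟₁, 𝒟₂`: **there is a rational point `P ∉ E_n(ℚ)[2] + 2E_n(ℚ)` with
`κ₂(P) = [⟨Λ₂,Λ₃⟩ odd]s₁ + [⟨Λ₁,Λ₃⟩ odd]s₂ + [⟨Λ₁,Λ₂⟩ odd]s₃`.** [cite: Cassels1998, the pairing on S⁽²⁾ (via Wang–Zhang 2022 §2.3)]
[cite: MilneADT2006, Ch. I §6 Thm. 6.13(a), Lemma 6.17] [cite: SilvermanAEC2009, Thm. X.4.2(a)] -/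
theorem exists_odd_point_kummer_eq_symbolAdjugate [dec : DecidableEq ℚ] (hsq : Squarefree n) [(congruentNumberCurve n).IsElliptic]
    (hr : (congruentNumberCurve n).mordellWeilRank = 1)
    (h₂ : Nat.card ((congruentNumberCurve n).selmerGroup 2) = 2 ^ 5)
    (h₄ : Nat.card ((congruentNumberCurve n).selmerGroup 4) = 2 ^ 6)
    (C : selmerGroup (congruentNumberCurve n) 2 →+ selmerGroup (congruentNumberCurve n) 2 →+ AddCircle (1 : ℚ))
    (halt : ∀ s, C s s = 0)
    (hl : ∀ s, (∀ t, C s t = 0) ↔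
      s ∈ (selmerZSMul (congruentNumberCurve n) (d := 2) (n := 4) 2 four_dvd_two_mul_two).range)
    (hB : ∀ (s t : selmerGroup (congruentNumberCurve n) 2) (d d' : Fin 3 → ℚˣ),
      HasComponents (congruentNumberCurve n) (TwoDescentLocal.splitTwoTorsion_cn n) (s : galH1Torsion (congruentNumberCurve n) 2) d →
        HasComponents (congruentNumberCurve n) (TwoDescentLocal.splitTwoTorsion_cn n) (t : galH1Torsion (congruentNumberCurve n) 2) d' →
          Nonempty (Datum ![-(n : ℚ), 0, n] (fun i => (d i : ℚ))) ∧
            ∀ 𝒟 : Datum ![-(n : ℚ), 0, n] (fun i => (d i : ℚ)), C s t = 0 ↔ 𝒟.IsEven (fun i => (d' i : ℚ)))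
    (hdiv : ∀ P : geomPoints (congruentNumberCurve n), ∃ Q : geomPoints (congruentNumberCurve n), (2 : ℤ) • Q = P)
    (s₁ s₂ s₃ : selmerGroup (congruentNumberCurve n) 2) (d₁ d₂ d₃ : Fin 3 → ℚˣ)
    (hd₁ : HasComponents (congruentNumberCurve n) (TwoDescentLocal.splitTwoTorsion_cn n) (s₁ : galH1Torsion (congruentNumberCurve n) 2) d₁)
    (hd₂ : HasComponents (congruentNumberCurve n) (TwoDescentLocal.splitTwoTorsion_cn n) (s₂ : galH1Torsion (congruentNumberCurve n) 2) d₂)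
    (hd₃ : HasComponents (congruentNumberCurve n) (TwoDescentLocal.splitTwoTorsion_cn n) (s₃ : galH1Torsion (congruentNumberCurve n) 2) d₃)
    (𝒟₁ : Datum ![-(n : ℚ), 0, n] (fun i => (d₁ i : ℚ))) (𝒟₂ : Datum ![-(n : ℚ), 0, n] (fun i => (d₂ i : ℚ)))
    (hgenK : ∀ t : selmerGroup (congruentNumberCurve n) 2, ∃ (P : (congruentNumberCurve n).toAffine.Point) (b₁ b₂ b₃ : ℤ),
      (2 : ℤ) • P = 0 ∧ (t : galH1Torsion (congruentNumberCurve n) 2) = kummerMapTorsion (congruentNumberCurve n) 2 hdiv P +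
        ((b₁ • s₁ + b₂ • s₂ + b₃ • s₃ : selmerGroup (congruentNumberCurve n) 2) : galH1Torsion (congruentNumberCurve n) 2)) :
    ∃ P : (congruentNumberCurve n).toAffine.Point,
      kummerMapTorsion (congruentNumberCurve n) 2 hdiv P =
        (((if 𝒟₂.IsEven (fun i => (d₃ i : ℚ)) then 0 else s₁) + (if 𝒟₁.IsEven (fun i => (d₃ i : ℚ)) then 0 else s₂) +
          (if 𝒟₁.IsEven (fun i => (d₂ i : ℚ)) then 0 else s₃) : selmerGroup (congruentNumberCurve n) 2) :
            galH1Torsion (congruentNumberCurve n) 2) ∧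
        ∀ T₀ Q : (congruentNumberCurve n).toAffine.Point, (2 : ℤ) • T₀ = 0 → P ≠ T₀ + (2 : ℤ) • Q := by
  have h₁₂ := (hB s₁ s₂ d₁ d₂ hd₁ hd₂).2 𝒟₁
  have h₁₃ := (hB s₁ s₃ d₁ d₃ hd₁ hd₃).2 𝒟₁
  have h₂₃ := (hB s₂ s₃ d₂ d₃ hd₂ hd₃).2 𝒟₂
  obtain rfl : dec = fun a b => Classical.propDecidable (a = b) := Subsingleton.elim _ _
  refine exists_odd_point_kummer_eq_adjugate_of_selmerFour hsq hr h₂ h₄ C halt hl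
    AdjugateForm.addCircle_two_torsion_collinear hdiv s₁ s₂ s₃ _ ?_ hgenK
  simp only [h₁₂, h₁₃, h₂₃]

/-- ★ **Every rational point is `≡ 0` or `≡` the symbol-adjugate vector modulo torsion classes** (jump-one class, same data as
`exists_odd_point_kummer_eq_symbolAdjugate`). [cite: Cassels1998, the pairing on S⁽²⁾ (via Wang–Zhang 2022 §2.3)]
[cite: MilneADT2006, Ch. I §6 Lemma 6.17] [cite: SilvermanAEC2009, Thm. X.4.2(a)] -/
theorem kummer_eq_or_eq_add_symbolAdjugate [dec : DecidableEq ℚ] (hsq : Squarefree n) [(congruentNumberCurve n).IsElliptic]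
    (hr : (congruentNumberCurve n).mordellWeilRank = 1)
    (h₂ : Nat.card ((congruentNumberCurve n).selmerGroup 2) = 2 ^ 5)
    (h₄ : Nat.card ((congruentNumberCurve n).selmerGroup 4) = 2 ^ 6)
    (C : selmerGroup (congruentNumberCurve n) 2 →+ selmerGroup (congruentNumberCurve n) 2 →+ AddCircle (1 : ℚ))
    (halt : ∀ s, C s s = 0)
    (hl : ∀ s, (∀ t, C s t = 0) ↔
      s ∈ (selmerZSMul (congruentNumberCurve n) (d := 2) (n := 4) 2 four_dvd_two_mul_two).range)
    (hB : ∀ (s t : selmerGroup (congruentNumberCurve n) 2) (d d' : Fin 3 → ℚˣ),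
      HasComponents (congruentNumberCurve n) (TwoDescentLocal.splitTwoTorsion_cn n) (s : galH1Torsion (congruentNumberCurve n) 2) d →
        HasComponents (congruentNumberCurve n) (TwoDescentLocal.splitTwoTorsion_cn n) (t : galH1Torsion (congruentNumberCurve n) 2) d' →
          Nonempty (Datum ![-(n : ℚ), 0, n] (fun i => (d i : ℚ))) ∧
            ∀ 𝒟 : Datum ![-(n : ℚ), 0, n] (fun i => (d i : ℚ)), C s t = 0 ↔ 𝒟.IsEven (fun i => (d' i : ℚ)))
    (hdiv : ∀ P : geomPoints (congruentNumberCurve n), ∃ Q : geomPoints (congruentNumberCurve n), (2 : ℤ) • Q = P)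
    (s₁ s₂ s₃ : selmerGroup (congruentNumberCurve n) 2) (d₁ d₂ d₃ : Fin 3 → ℚˣ)
    (hd₁ : HasComponents (congruentNumberCurve n) (TwoDescentLocal.splitTwoTorsion_cn n) (s₁ : galH1Torsion (congruentNumberCurve n) 2) d₁)
    (hd₂ : HasComponents (congruentNumberCurve n) (TwoDescentLocal.splitTwoTorsion_cn n) (s₂ : galH1Torsion (congruentNumberCurve n) 2) d₂)
    (hd₃ : HasComponents (congruentNumberCurve n) (TwoDescentLocal.splitTwoTorsion_cn n) (s₃ : galH1Torsion (congruentNumberCurve n) 2) d₃)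
    (𝒟₁ : Datum ![-(n : ℚ), 0, n] (fun i => (d₁ i : ℚ))) (𝒟₂ : Datum ![-(n : ℚ), 0, n] (fun i => (d₂ i : ℚ)))
    (hgenK : ∀ t : selmerGroup (congruentNumberCurve n) 2, ∃ (P : (congruentNumberCurve n).toAffine.Point) (b₁ b₂ b₃ : ℤ),
      (2 : ℤ) • P = 0 ∧ (t : galH1Torsion (congruentNumberCurve n) 2) = kummerMapTorsion (congruentNumberCurve n) 2 hdiv P +
        ((b₁ • s₁ + b₂ • s₂ + b₃ • s₃ : selmerGroup (congruentNumberCurve n) 2) : galH1Torsion (congruentNumberCurve n) 2))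
    (P : (congruentNumberCurve n).toAffine.Point) :
    ∃ T₀ : (congruentNumberCurve n).toAffine.Point, (2 : ℤ) • T₀ = 0 ∧
      (kummerMapTorsion (congruentNumberCurve n) 2 hdiv P = kummerMapTorsion (congruentNumberCurve n) 2 hdiv T₀ ∨
        kummerMapTorsion (congruentNumberCurve n) 2 hdiv P = kummerMapTorsion (congruentNumberCurve n) 2 hdiv T₀ +
          (((if 𝒟₂.IsEven (fun i => (d₃ i : ℚ)) then 0 else s₁) + (if 𝒟₁.IsEven (fun i => (d₃ i : ℚ)) then 0 else s₂) +
            (if 𝒟₁.IsEven (fun i => (d₂ i : ℚ)) then 0 else s₃) : selmerGroup (congruentNumberCurve n) 2) :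
              galH1Torsion (congruentNumberCurve n) 2)) := by
  have h₁₂ := (hB s₁ s₂ d₁ d₂ hd₁ hd₂).2 𝒟₁
  have h₁₃ := (hB s₁ s₃ d₁ d₃ hd₁ hd₃).2 𝒟₁
  have h₂₃ := (hB s₂ s₃ d₂ d₃ hd₂ hd₃).2 𝒟₂
  obtain rfl : dec = fun a b => Classical.propDecidable (a = b) := Subsingleton.elim _ _
  refine kummer_eq_or_eq_add_adjugate_of_selmerFour hsq hr h₂ h₄ C halt hl
    AdjugateForm.addCircle_two_torsion_collinear hdiv s₁ s₂ s₃ _ ?_ hgenK P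
  simp only [h₁₂, h₁₃, h₂₃]

end JumpOne

end Summit.BirchSwinnertonDyer.PrintCf2.CasselsSymbols

end
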